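import Summits.BirchSwinnertonDyer.BirchSwinnertonDyer.Theorems.GenusKolyvaginAtTwoKolyvaginRelationAtTwo
import Summits.BirchSwinnertonDyer.BirchSwinnertonDyer.Theorems.KolyvaginRankRigidityAtTwoOffHabitatIrredRingClassNoTwoTorsion
import HarnessLib

/-!
# Route `KolyvaginRankRigidityAtTwo`, residual crux R_irr `OffHabitatIrredNonSurjTwoConverse`
# (stmt-BirchSwinnertonDyer-27123, LINE 8 «margin absorbs index»): the KOLYVAGIN RELATION AT `2`
# (GK2 Q2, McCallum 1991 Prop. 4.4 «in particular») OFF THE HABITAT — from `E(ℚ)[2] = 0` instead of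
# the surjective `2`-adic tower (helper, PROVED modulo the print fact `prop37_2_reductionCongruence_inert`
# exactly like Q2 on the habitat; width seat `bsd-line-krr2-p2` g9)

GK2's Q2 `KolyvaginRelationAtTwo` (stmt-24880; tree theorem `GenusExact.kolyvaginRelationAtTwo_of_prop37_2`,
modulo Gross 3.7(2)) is the input T1 «local triviality at the conductor» of the KRR `∞`-kernel
(`stub_localTrivialAtConductor_of_kolyvaginRelationAtTwo`, the LEAD's hybrid swap frames, U2). Its frame
carries the binder `∀ n, ρ̄_{E,2^n} onto`, but the proof (`kolyvaginRelationAtTwo_pair_of_congruence`)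
consumes the image ONLY through the admissibility binder `hA` — `E(K[m])[2^M] = 0`, `E(K[mℓ])[2^M] = 0`
(`isAdmissible_pointsSubgroup_two_of_heegner … (hρ 1)`). This file swaps that input for the off-habitat
one landed this generation and obtains Q2 ON THE FRAME OF R_irr (`E(ℚ)[2] = 0`, any `2`-adic image):

* `isAdmissible_pointsSubgroup_two_of_torsionBy_eq_bot` — the `hA` binder at `p = 2` for EVERY level
  `n ≠ 0` from `E(ℚ)[2] = 0`, `d_K ≠ -4` and the Heegner hypothesis: the cyclic-cubic case
  `Δ ∈ ℚ^{×2}` by `KolyvaginRankRigidity.twoTorsion_eq_zero_ringClassField_of_isSquare` (Cox 9.3), the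
  case `Δ ∉ ℚ^{×2}` (= `ρ̄_{E,2}` onto, Dokchitser–Dokchitser (1)) by GK2's `isAdmissible_pointsSubgroup_two`
  with `d_K·Δ ∉ ℚ^{×2}` from `not_isSquare_discr_mul_Δ_of_satisfiesHeegnerHypothesis`;
* `kolyvaginRelationAtTwo_pair_of_congruence_offHabitat` — GK2's pair theorem with `hρ` replaced by
  `E(ℚ)[2] = 0` (proof verbatim otherwise);
* `kolyvaginRelationAtTwo_offHabitat_of_prop37_2`, `…_of_frobeniusCongruence` — **Q2's text with the
  binder `(∀ n, ρ̄_{E,2^n} onto)` replaced by `E(ℚ)[2] = 0`**, modulo the same print fact.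

HONEST FRAMING: helper (`--supports` 27123), CONDITIONAL on Gross 1991 Prop. 3.7 (2) (print item 23091)
exactly as Q2 is; nothing here closes R_irr, Q2 24880, U1 28083 or 23091; BSD is NOT proved by any of this.

References: [McCallumLMS1991] §4 Prop. 4.4 «In particular», (4), (5); [GrossLMS1991] Prop. 3.7 (2),
Lemma 4.3; [Nekovar2007] Prop. 4.9; [Cox2013] §9.A Lemma 9.3; [DokchitserDokchitserMathZ2012] Theorem (1).
-/

set_option autoImplicit false
-- the Theorems namespace of this sub repeats the summit name by design (D-0017 nested layout)
set_option linter.dupNamespace false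

noncomputable section

open scoped Classical

namespace Summit.BirchSwinnertonDyer.BirchSwinnertonDyer.Theorems.GenusExact

open WeierstrassCurve Field NumberField IsDedekindDomain Finset
open Literature.NumberTheory.EllipticCurves Literature.NumberTheory.GaloisRepresentations
open Literature.NumberTheory.EllipticCurves.KolyvaginCocycle
open Literature.NumberTheory.EllipticCurves.RingClassField Literature.NumberTheory.EllipticCurves.ModularForms
open Literature.NumberTheory.EllipticCurves.GrossLMS1991
open Summit.BirchSwinnertonDyer.Rank1Residual.X11b

variable {K : Type} [Field K] [NumberField K] {W : WeierstrassCurve ℚ}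

/-! ## §1 The `hA` binder at every level from `E(ℚ)[2] = 0` -/

section Admissible

variable {N : ℕ} [NeZero N] {Dt : ModularParametrizationData W N} {β : ℤ} {ι : K →+* ℂ} {n : ℕ}

/-- **`E(K[n])[2^M] = 0` in the cyclic-cubic case, any level `n ≠ 0`** (`E(K)[2] = 0`, `Δ ∈ ℚ^{×2}`).
[cite: GrossLMS1991, §4 Lemma 4.3] [cite: Cox2013, §9.A Lemma 9.3] -/
theorem torsionBy_two_pow_ringClassField_eq_bot_of_isSquare [W.IsElliptic]
    (hnoK : ∀ Q : (W.baseChange K).toAffine.Point, 2 • Q = 0 → Q = 0) (hsq : IsSquare W.Δ)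
    (hK : IsImaginaryQuadratic K) (ι : K →+* ℂ) (hn : n ≠ 0) (M : ℕ) :
    AddSubgroup.torsionBy (W.baseChange (ringClassField K ι n)).toAffine.Point ((2 ^ M : ℕ) : ℤ) =
      ⊥ := by
  refine torsionBy_pow_eq_bot (p := 2) ?_ M
  rw [eq_bot_iff]
  intro P hP
  rw [AddSubgroup.mem_bot]
  exact KolyvaginRankRigidity.twoTorsion_eq_zero_ringClassField_of_isSquare W hnoK hsq hK ι hn P
    (by rw [← natCast_zsmul, Nat.cast_ofNat]; exact (Submodule.mem_torsionBy_iff (2 : ℤ) P).mp hP)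

/-- **The `hA` binder of McCallum's class AT `p = 2` from `E(ℚ)[2] = 0`** (any `2`-adic image), for
every concrete Kolyvagin–Heegner datum `d` at a level `n ≠ 0`, `K` imaginary quadratic with
`d_K ≠ -4` and the Heegner hypothesis for `N_E` (`W` globally minimal): `E(K[n]) ⊆ E(K̄)` is
`Γ_K`-stable and `2^M`-torsion-free. Cases: `Δ ∈ ℚ^{×2}` (Cox 9.3 road) / `Δ ∉ ℚ^{×2}` (`ρ̄_{E,2}`
onto: GK2's `isAdmissible_pointsSubgroup_two` with `d_K·Δ ∉ ℚ^{×2}` from the Heegner hypothesis).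
[cite: McCallumLMS1991, §4 (5)] [cite: GrossLMS1991, §4 Lemma 4.3 and (4.2)] -/
theorem isAdmissible_pointsSubgroup_two_of_torsionBy_eq_bot [W.IsElliptic] [W.IsGloballyMinimal]
    (d : KolyvaginHeegnerData Dt β ι n) (htorQ : AddSubgroup.torsionBy W.toAffine.Point (2 : ℤ) = ⊥)
    (hK : IsImaginaryQuadratic K) (hn : n ≠ 0) (hD4 : NumberField.discr K ≠ -4)
    (hH : SatisfiesHeegnerHypothesis (W.conductorNorm ℤ) K) (M : ℕ) :
    IsAdmissible (absoluteGaloisGroup K) d.pointsSubgroup ((2 ^ M : ℕ) : ℤ) := by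
  have hnoQ : ∀ Q : W.toAffine.Point, 2 • Q = 0 → Q = 0 := by
    have h := (KolyvaginRankRigidity.torsionBy_two_eq_bot_iff_forall_two_nsmul).mp htorQ
    exact fun Q hQ ↦ h Q (by convert hQ)
  by_cases hsq : IsSquare W.Δ
  · have hnoK : ∀ Q : (W.baseChange K).toAffine.Point, 2 • Q = 0 → Q = 0 :=
      (KolyvaginRankRigidity.torsionBy_two_eq_bot_iff_forall_two_nsmul).mp
        (KolyvaginRankRigidity.stub_noTwoTorsionOverK_of_irred W htorQ K hK)
    exact
      { smul_mem := fun g ↦ by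
          rintro _ ⟨P, rfl⟩
          exact ⟨_, (RingClassNoTorsion.smul_toGeomPoints_eq d hK hn g P).symm⟩
        eq_zero_of_zsmul := by
          rintro _ ⟨P, rfl⟩ hP
          rw [← map_zsmul] at hP
          have hP0 : ((2 ^ M : ℕ) : ℤ) • P = 0 :=
            (Affine.Point.map_injective (W' := W) d.emb.toRatAlgHom) (by rw [map_zero]; exact hP)
          have hmem : P ∈ AddSubgroup.torsionBy (W.baseChange (ringClassField K ι n)).toAffine.Point
              ((2 ^ M : ℕ) : ℤ) := (Submodule.mem_torsionBy_iff _ P).mpr hP0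
          rw [torsionBy_two_pow_ringClassField_eq_bot_of_isSquare hnoK hsq hK ι hn M,
            AddSubgroup.mem_bot] at hmem
          rw [hmem, map_zero] }
  · have hs : W.HasSurjectiveModNGaloisRep 2 :=
      (hasSurjectiveModNGaloisRep_two_iff W).mpr ⟨fun Q hQ ↦ hnoQ Q (by convert hQ), hsq⟩
    exact isAdmissible_pointsSubgroup_two d hK hn hs
      (not_isSquare_discr_mul_Δ_of_satisfiesHeegnerHypothesis W hK hH hD4) M

end Admissible

/-! ## §2 The pair theorem off the habitat -/


set_option maxHeartbeats 800000 in
/-- **McCallum's Prop. 4.4 «in particular» AT `p = 2` for a compatible pair `(d at m, d' at mℓ)`, OFF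
THE HABITAT**: GK2's `kolyvaginRelationAtTwo_pair_of_congruence` with the binder `∀ n, ρ̄_{E,2^n} onto`
replaced by `E(ℚ)[2] = 0` — the image was consumed only through the `hA` binders, now supplied by
`isAdmissible_pointsSubgroup_two_of_torsionBy_eq_bot`; everything else verbatim.
[cite: McCallumLMS1991, §4 Prop. 4.4 «In particular» (p. 301), (4), (5)]
[cite: GrossLMS1991, Prop. 3.6, 3.7 (2), Lemma 4.3] -/
theorem kolyvaginRelationAtTwo_pair_of_congruence_offHabitat [W.IsElliptic] [W.IsGloballyMinimal]
    [NeZero (W.conductorNorm ℤ)] (hK : IsImaginaryQuadratic K)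
    (hD3 : NumberField.discr K ≠ -3) (hD4 : NumberField.discr K ≠ -4)
    (hH : SatisfiesHeegnerHypothesis (W.conductorNorm ℤ) K)
    (htorQ : AddSubgroup.torsionBy W.toAffine.Point (2 : ℤ) = ⊥)
    (Dt : ModularParametrizationData W (W.conductorNorm ℤ)) (β : ℤ) (ι : K →+* ℂ) (M : ℕ)
    (m l : ℕ) (hsq : Squarefree (m * l)) (hl : l.Prime) (_hlm : ¬ l ∣ m)
    (hS : ∀ l' ∈ (m * l).primeFactors, Zhang2014.IsKolyvaginPrime (W.conductorNorm ℤ) W K 2 l' ∧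
      M ≤ Zhang2014.kolyvaginIndex W 2 l')
    (d : KolyvaginHeegnerData Dt β ι m) (d' : KolyvaginHeegnerData Dt β ι (m * l))
    (hσ : ∀ l' ∈ m.primeFactors, ∀ (x : ringClassField K ι m) (x' : ringClassField K ι (m * l)),
      (x : ℂ) = x' → ((d'.σ l' x' : ringClassField K ι (m * l)) : ℂ) = (d.σ l' x : ℂ))
    (hS₁ : ∀ s ∈ d.S, ∃ s' ∈ d'.S, ∀ (x : ringClassField K ι m) (x' : ringClassField K ι (m * l)),
      (x : ℂ) = x' → ((s' x' : ringClassField K ι (m * l)) : ℂ) = (s x : ℂ))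
    (hS₂ : ∀ s' ∈ d'.S, ∃ s ∈ d.S, ∀ (x : ringClassField K ι m) (x' : ringClassField K ι (m * l)),
      (x : ℂ) = x' → ((s' x' : ringClassField K ι (m * l)) : ℂ) = (s x : ℂ))
    (hemb : ∀ (x : ringClassField K ι m) (x' : ringClassField K ι (m * l)),
      (x : ℂ) = x' → d'.emb x' = d.emb x)
    (hγ : ∀ [Fact l.Prime] (hΔ : ¬ (l : ℤ) ∣ minimalDiscriminantInt W)
      (φ₀ : absoluteGaloisGroup (ZMod l)), (∀ x : AlgebraicClosure (ZMod l), φ₀ • x = x ^ l) →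
      ∀ (hle : ringClassField K ι m ≤ ringClassField K ι (m * l))
        (γ : ringClassField K ι (m * l) ≃ₐ[ℚ] ringClassField K ι (m * l)), γ ∈ ringClassGal ι (m * l) →
        geomReduction hΔ ((RatClosure.pointsEquiv (K := K) W).symm
            (d'.toGeomPoints (pointGalHom W (ringClassField K ι (m * l)) γ d'.y))) =
          φ₀ • geomReduction hΔ ((RatClosure.pointsEquiv (K := K) W).symm
            (d'.toGeomPoints (pointGalHom W (ringClassField K ι (m * l)) γ
              (WeierstrassCurve.Affine.Point.map (W' := W)
                (letI : Algebra K ℂ := ι.toAlgebra; (RingClassField.inclusion ι hle).restrictScalars ℚ)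
                d.y)))))
    (v : HeightOneSpectrum (𝓞 K)) (hv : (l : 𝓞 K) ∈ v.asIdeal) (j : ℕ) :
    ((((2 ^ j : ℕ) : ℤ) • d'.kolyvaginClass Nat.prime_two M ∈
          selmerLocalKer (W.baseChange K) (v.adicCompletion K) ((2 ^ M : ℕ) : ℤ) ↔
        ((2 ^ j : ℕ) : ℤ) • d'.kolyvaginClass Nat.prime_two M ∈
          (W.baseChange K).torsionLocalKer (v.adicCompletion K) ((2 ^ M : ℕ) : ℤ)) ∧
      (((2 ^ j : ℕ) : ℤ) • d'.kolyvaginClass Nat.prime_two M ∈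
          (W.baseChange K).torsionLocalKer (v.adicCompletion K) ((2 ^ M : ℕ) : ℤ) ↔
        ((2 ^ j : ℕ) : ℤ) • d.kolyvaginClass Nat.prime_two M ∈
          (W.baseChange K).torsionLocalKer (v.adicCompletion K) ((2 ^ M : ℕ) : ℤ))) := by
  have hD : NumberField.discr K < -4 := KolyvaginAssembly.discr_lt_neg_four hK ⟨hD3, hD4⟩
  have hn0 : m * l ≠ 0 := hsq.ne_zero
  have hm0 : m ≠ 0 := fun h ↦ hn0 (by rw [h, zero_mul])
  have hl' : l ∈ (m * l).primeFactors := Nat.mem_primeFactors.mpr ⟨hl, dvd_mul_left l m, hn0⟩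
  have hmn : m * l / l = m := Nat.mul_div_cancel m hl.pos
  have hSm : ∀ q ∈ m.primeFactors, Zhang2014.IsKolyvaginPrime (W.conductorNorm ℤ) W K 2 q ∧
      M ≤ Zhang2014.kolyvaginIndex W 2 q :=
    fun q hq ↦ hS q (Nat.primeFactors_mono (dvd_mul_right m l) hn0 hq)
  -- McCallum's standing inputs at the two levels, OFF the habitat
  have hA : IsAdmissible (absoluteGaloisGroup K) d.pointsSubgroup ((2 ^ M : ℕ) : ℤ) :=
    isAdmissible_pointsSubgroup_two_of_torsionBy_eq_bot d htorQ hK hm0 hD4 hH M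
  have hA' : IsAdmissible (absoluteGaloisGroup K) d'.pointsSubgroup ((2 ^ M : ℕ) : ℤ) :=
    isAdmissible_pointsSubgroup_two_of_torsionBy_eq_bot d' htorQ hK hn0 hD4 hH M
  have hPt := Prop44.toGeomPoints_derivedPoint_mem_invPoints hK ι hD hH Dt Nat.prime_two
    (hsq.squarefree_of_dvd (dvd_mul_right m l)) hSm d
  have hPt' := Prop44.toGeomPoints_derivedPoint_mem_invPoints hK ι hD hH Dt Nat.prime_two hsq hS d'
  exact zsmul_kolyvaginClass_localOrders_of_compat_two hK ι hD hH Dt hsq hS hl' hmn d' d hσ hS₁ hS₂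
    hemb hγ hA' hA hPt' hPt v hv _

/-! ## §3 Q2's text off the habitat, modulo the print fact -/

/-- **The Kolyvagin relation at `2` OFF THE HABITAT (Q2's text with `∀ n, ρ̄_{E,2^n} onto` replaced by
`E(ℚ)[2] = 0`), from Gross 1991 Prop. 3.7 (2)** in the tree's `p`-free, image-free form
`prop37_2_reductionCongruence_inert` at `N = N_W` (PUBLISHED; print item 23091's consumer interface).
CONDITIONAL on that print fact and nothing else. [cite: McCallumLMS1991, §4 Prop. 4.4 «In particular»]
[cite: GrossLMS1991, Prop. 3.7 (2) (p. 240)] [cite: Nekovar2007, Prop. 4.9] -/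
theorem kolyvaginRelationAtTwo_offHabitat_of_prop37_2
    (h37 : ∀ (W : WeierstrassCurve ℚ) [W.IsGloballyMinimal] [NeZero (W.conductorNorm ℤ)]
      (K : Type) [Field K] [NumberField K],
      prop37_2_reductionCongruence_inert (W.conductorNorm ℤ) W K) :
    ∀ (W : WeierstrassCurve ℚ) [W.IsElliptic] [W.IsGloballyMinimal] [NeZero (W.conductorNorm ℤ)], ¬ W.HasCM
      → ∀ (K : Type) [Field K] [NumberField K], Literature.NumberTheory.EllipticCurves.IsImaginaryQuadratic
      K → NumberField.discr K ≠ -3 → NumberField.discr K ≠ -4 →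
      Literature.NumberTheory.EllipticCurves.SatisfiesHeegnerHypothesis (W.conductorNorm ℤ) K →
      AddSubgroup.torsionBy W.toAffine.Point (2 : ℤ) = ⊥ → ∀ (Dt :
      Literature.NumberTheory.EllipticCurves.ModularForms.ModularParametrizationData W (W.conductorNorm ℤ))
      (β : ℤ) (ι : K →+* ℂ) (M : ℕ), 1 ≤ M → ∀ (m l : ℕ), Squarefree (m * l) → l.Prime → ¬ l ∣ m → (∀ l' ∈
      (m * l).primeFactors, Literature.NumberTheory.EllipticCurves.Zhang2014.IsKolyvaginPrime
      (W.conductorNorm ℤ) W K 2 l' ∧ M ≤ Literature.NumberTheory.EllipticCurves.Zhang2014.kolyvaginIndex W 2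
      l') → ∀ (d : Literature.NumberTheory.EllipticCurves.KolyvaginHeegnerData Dt β ι m) (d' :
      Literature.NumberTheory.EllipticCurves.KolyvaginHeegnerData Dt β ι (m * l)), (∀ l' ∈ m.primeFactors, ∀
      (x : Literature.NumberTheory.EllipticCurves.ringClassField K ι m) (x' :
      Literature.NumberTheory.EllipticCurves.ringClassField K ι (m * l)), (x : ℂ) = x' → ((d'.σ l' x' :
      Literature.NumberTheory.EllipticCurves.ringClassField K ι (m * l)) : ℂ) = (d.σ l' x : ℂ)) → (∀ s ∈
      d.S, ∃ s' ∈ d'.S, ∀ (x : Literature.NumberTheory.EllipticCurves.ringClassField K ι m) (x' :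
      Literature.NumberTheory.EllipticCurves.ringClassField K ι (m * l)), (x : ℂ) = x' → ((s' x' :
      Literature.NumberTheory.EllipticCurves.ringClassField K ι (m * l)) : ℂ) = (s x : ℂ)) → (∀ s' ∈ d'.S, ∃
      s ∈ d.S, ∀ (x : Literature.NumberTheory.EllipticCurves.ringClassField K ι m) (x' :
      Literature.NumberTheory.EllipticCurves.ringClassField K ι (m * l)), (x : ℂ) = x' → ((s' x' :
      Literature.NumberTheory.EllipticCurves.ringClassField K ι (m * l)) : ℂ) = (s x : ℂ)) → (∀ (x :
      Literature.NumberTheory.EllipticCurves.ringClassField K ι m) (x' :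
      Literature.NumberTheory.EllipticCurves.ringClassField K ι (m * l)), (x : ℂ) = x' → d'.emb x' = d.emb
      x) → ∀ (v : IsDedekindDomain.HeightOneSpectrum (NumberField.RingOfIntegers K)), (l :
      NumberField.RingOfIntegers K) ∈ v.asIdeal → ∀ (j : ℕ), ((((2 ^ j : ℕ) : ℤ) • d'.kolyvaginClass
      Nat.prime_two M ∈ WeierstrassCurve.selmerLocalKer (W.baseChange K) (v.adicCompletion K) ((2 ^ M : ℕ) :
      ℤ) ↔ ((2 ^ j : ℕ) : ℤ) • d'.kolyvaginClass Nat.prime_two M ∈ (W.baseChange K).torsionLocalKer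
      (v.adicCompletion K) ((2 ^ M : ℕ) : ℤ)) ∧ (((2 ^ j : ℕ) : ℤ) • d'.kolyvaginClass Nat.prime_two M ∈
      (W.baseChange K).torsionLocalKer (v.adicCompletion K) ((2 ^ M : ℕ) : ℤ) ↔ ((2 ^ j : ℕ) : ℤ) •
      d.kolyvaginClass Nat.prime_two M ∈ (W.baseChange K).torsionLocalKer (v.adicCompletion K) ((2 ^ M : ℕ)
      : ℤ))) := by
  intro W _ _ _ _ K _ _ hK hD3 hD4 hH htorQ Dt β ι M _ m l hsq hl hlm hS d d' hσ hS₁ hS₂ hemb v hv j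
  have hn0 : m * l ≠ 0 := hsq.ne_zero
  have hl' : l ∈ (m * l).primeFactors := Nat.mem_primeFactors.mpr ⟨hl, dvd_mul_left l m, hn0⟩
  have hodd : ∀ q ∈ (m * l).primeFactors, q ≠ 2 := fun q hq ↦
    zhangKolyvaginPrime_ne_two Nat.prime_two (by norm_num) (hS q hq).1
  have hinert : ∀ q ∈ (m * l).primeFactors, ¬ q ∣ W.conductorNorm ℤ ∧
      ¬ ((q : ℤ) ∣ NumberField.discr K) ∧ (Ideal.span {(q : 𝓞 K)}).IsPrime :=
    fun q hq ↦ ⟨(hS q hq).1.2.1, (hS q hq).1.2.2.1, (hS q hq).1.2.2.2.2.1⟩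
  exact kolyvaginRelationAtTwo_pair_of_congruence_offHabitat hK hD3 hD4 hH htorQ Dt β ι M m l hsq hl hlm
    hS d d' hσ hS₁ hS₂ hemb (congruence_pair_of_prop37_2_inert (h37 W K) rfl hK ⟨hD3, hD4⟩ hH Dt β ι hsq
      hodd hinert hl' (Nat.mul_div_cancel m hl.pos) d' d) v hv j

/-- The same from Nekovář's image-free congruence `prop37_2_frobeniusCongruence` (= item 23091's decl).
[cite: Nekovar2007, Prop. 4.9] [cite: GrossLMS1991, Prop. 3.7 (2)] -/
theorem kolyvaginRelationAtTwo_offHabitat_of_frobeniusCongruence (h : prop37_2_frobeniusCongruence) :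
    ∀ (W : WeierstrassCurve ℚ) [W.IsElliptic] [W.IsGloballyMinimal] [NeZero (W.conductorNorm ℤ)], ¬ W.HasCM
      → ∀ (K : Type) [Field K] [NumberField K], Literature.NumberTheory.EllipticCurves.IsImaginaryQuadratic
      K → NumberField.discr K ≠ -3 → NumberField.discr K ≠ -4 →
      Literature.NumberTheory.EllipticCurves.SatisfiesHeegnerHypothesis (W.conductorNorm ℤ) K →
      AddSubgroup.torsionBy W.toAffine.Point (2 : ℤ) = ⊥ → ∀ (Dt :
      Literature.NumberTheory.EllipticCurves.ModularForms.ModularParametrizationData W (W.conductorNorm ℤ))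
      (β : ℤ) (ι : K →+* ℂ) (M : ℕ), 1 ≤ M → ∀ (m l : ℕ), Squarefree (m * l) → l.Prime → ¬ l ∣ m → (∀ l' ∈
      (m * l).primeFactors, Literature.NumberTheory.EllipticCurves.Zhang2014.IsKolyvaginPrime
      (W.conductorNorm ℤ) W K 2 l' ∧ M ≤ Literature.NumberTheory.EllipticCurves.Zhang2014.kolyvaginIndex W 2
      l') → ∀ (d : Literature.NumberTheory.EllipticCurves.KolyvaginHeegnerData Dt β ι m) (d' :
      Literature.NumberTheory.EllipticCurves.KolyvaginHeegnerData Dt β ι (m * l)), (∀ l' ∈ m.primeFactors, ∀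
      (x : Literature.NumberTheory.EllipticCurves.ringClassField K ι m) (x' :
      Literature.NumberTheory.EllipticCurves.ringClassField K ι (m * l)), (x : ℂ) = x' → ((d'.σ l' x' :
      Literature.NumberTheory.EllipticCurves.ringClassField K ι (m * l)) : ℂ) = (d.σ l' x : ℂ)) → (∀ s ∈
      d.S, ∃ s' ∈ d'.S, ∀ (x : Literature.NumberTheory.EllipticCurves.ringClassField K ι m) (x' :
      Literature.NumberTheory.EllipticCurves.ringClassField K ι (m * l)), (x : ℂ) = x' → ((s' x' :
      Literature.NumberTheory.EllipticCurves.ringClassField K ι (m * l)) : ℂ) = (s x : ℂ)) → (∀ s' ∈ d'.S, ∃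
      s ∈ d.S, ∀ (x : Literature.NumberTheory.EllipticCurves.ringClassField K ι m) (x' :
      Literature.NumberTheory.EllipticCurves.ringClassField K ι (m * l)), (x : ℂ) = x' → ((s' x' :
      Literature.NumberTheory.EllipticCurves.ringClassField K ι (m * l)) : ℂ) = (s x : ℂ)) → (∀ (x :
      Literature.NumberTheory.EllipticCurves.ringClassField K ι m) (x' :
      Literature.NumberTheory.EllipticCurves.ringClassField K ι (m * l)), (x : ℂ) = x' → d'.emb x' = d.emb
      x) → ∀ (v : IsDedekindDomain.HeightOneSpectrum (NumberField.RingOfIntegers K)), (l :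
      NumberField.RingOfIntegers K) ∈ v.asIdeal → ∀ (j : ℕ), ((((2 ^ j : ℕ) : ℤ) • d'.kolyvaginClass
      Nat.prime_two M ∈ WeierstrassCurve.selmerLocalKer (W.baseChange K) (v.adicCompletion K) ((2 ^ M : ℕ) :
      ℤ) ↔ ((2 ^ j : ℕ) : ℤ) • d'.kolyvaginClass Nat.prime_two M ∈ (W.baseChange K).torsionLocalKer
      (v.adicCompletion K) ((2 ^ M : ℕ) : ℤ)) ∧ (((2 ^ j : ℕ) : ℤ) • d'.kolyvaginClass Nat.prime_two M ∈
      (W.baseChange K).torsionLocalKer (v.adicCompletion K) ((2 ^ M : ℕ) : ℤ) ↔ ((2 ^ j : ℕ) : ℤ) •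
      d.kolyvaginClass Nat.prime_two M ∈ (W.baseChange K).torsionLocalKer (v.adicCompletion K) ((2 ^ M : ℕ)
      : ℤ))) :=
  kolyvaginRelationAtTwo_offHabitat_of_prop37_2 fun W _ _ K _ _ ↦
    prop37_2_reductionCongruence_inert_of_frobeniusCongruence h (W.conductorNorm ℤ) W K

end Summit.BirchSwinnertonDyer.BirchSwinnertonDyer.Theorems.GenusExact

end
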